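import Literature.MathematicalPhysics.QuantumManyBody.LiebSimpleEquationFacts
import Mathlib.MeasureTheory.Function.L2Space
import HarnessLib

/-!
# Lieb's simple equation (Carlen–Jauslin–Lieb): proved parts of CJL-I Theorem 2

Topic: `Literature/MathematicalPhysics/QuantumManyBody`. Companion of `LiebSimpleEquationFacts.lean`,
where CJL-I Theorem 2 is the named fact `CarlenJauslinLieb2020_thm2` — the conjunction of three
printed statements (CJL-I = Carlen–Jauslin–Lieb, Pure Appl. Anal. 2 (2020), arXiv:1912.04987):

1. "for each `ρ > 0` there is at least one `e > 0` such that `ρ = ρ(e)`";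
2. low density: `e = 2πρa(1 + 128/(15√π)√(ρa³) + o(√ρ))` (§3.2);
3. high density: `e = (ρ/2)∫𝒱 + o(ρ)` (§3.1).

This file proves (3) outright and (1) from CJL-I Theorem 1 (the named fact
`CarlenJauslinLieb2020_thm1`), following the printed arguments; (2) — the heart of CJL-I §3.2
(Fourier analysis of the solution, the zero-energy scattering solution `φ = lim_{e→0} K_e𝒱`, two
dominated-convergence estimates and an explicit integral over `ℝ³`) — is not proved in the tree, so
`CarlenJauslinLieb2020_thm2` itself stays a named fact.

## Contents

* `IsSolution.integrable_mul`, `IsSolution.energy_eq_sub` (`e = (ρ/2)∫𝒱 − (ρ/2)∫u𝒱`, the energy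
  constraint (1.2) expanded), `IsSolution.energy_le` (`e ≤ (ρ/2)∫𝒱`, CJL-I (3.2)).
* `CarlenJauslinLieb2020_thm2_highDensity` — statement (3) in the uniform rendering of the fact:
  `∀ ε > 0 ∃ ρ₁ ∀ (ρ, e, u) solution triple, ρ > ρ₁ → |e − (ρ/2)∫𝒱| ≤ ερ`. Printed proof (§3.1,
  Lemma "high density asymptotics"): `(ρ/2)∫𝒱 − e = (ρ/2)∫u_ρ𝒱` and `∫u_ρ𝒱 → 0` because
  `∫u_ρ = 1/ρ` ((1.6), the tree's `IsSolution.integral_eq`); CJL split `𝒱` along its level sets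
  `{𝒱 ≥ γ}` (which needs only `𝒱 ∈ L¹`); since Theorem 2 assumes `𝒱 ∈ L²` we use instead the
  one-line bound `2u𝒱 ≤ t·u + 𝒱²/t` (`u² ≤ u ≤ 1`), giving the explicit threshold
  `ρ₁ = ∫𝒱²/(4ε²) + 1/2`.
* `exists_energy_of_thm1`, `CarlenJauslinLieb2020_thm2_exists_of_thm1` — statement (1) from
  Theorem 1, as printed (third remark after Theorem 1; last lemma of §2): the intermediate value
  theorem for the continuous `ρ(e)` with `ρ(0⁺) = 0`, `ρ(∞) = ∞`, on a segment `[e₁, e₂] ⊂ (0, ∞)`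
  with `ρ(e₁) < ρ < ρ(e₂)`.

## References

* [CarlenJauslinLieb2020] E. A. Carlen, I. Jauslin, E. H. Lieb, *Analysis of a simple equation for
  the ground state energy of the Bose gas*, Pure Appl. Anal. 2 (2020) 659–684, arXiv:1912.04987:
  Theorem 1 and the remarks after it, Theorem 2, (1.2), (1.6), §2 (last lemma), §3.1 ((3.2) and the
  high-density lemma).
-/

noncomputable section

open MeasureTheory Filter Set
open scoped ENNReal Topology

namespace Literature.MathematicalPhysics.QuantumManyBody

namespace LiebSimpleEquation

open BoseGas (Space)

/-! ## The energy constraint, expanded -/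

/-- For a solution `u` (`0 ≤ u ≤ 1`) and integrable `𝒱`, `u𝒱` is integrable.
[cite: CarlenJauslinLieb2020, (1.10)–(1.11)] -/
theorem IsSolution.integrable_mul {𝒱 : Space → ℝ} {ρ e : ℝ} {u : Space → ℝ}
    (hu : IsSolution 𝒱 ρ e u) (h1 : Integrable 𝒱) : Integrable fun y => u y * 𝒱 y := by
  refine h1.bdd_mul (c := 1) hu.integrable.aestronglyMeasurable (Eventually.of_forall fun x => ?_)
  have := hu.nonneg x
  have := hu.le_one x
  rw [Real.norm_eq_abs, abs_le]
  constructor <;> linarith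

/-- **The energy constraint, expanded**: `e = (ρ/2)∫𝒱 − (ρ/2)∫u𝒱` for a solution at `(ρ, e)`
with `𝒱` integrable (CJL-I (1.2); the first line of the proof of the high-density lemma, §3.1).
[cite: CarlenJauslinLieb2020, (1.2) and §3.1] -/
theorem IsSolution.energy_eq_sub {𝒱 : Space → ℝ} {ρ e : ℝ} {u : Space → ℝ}
    (hu : IsSolution 𝒱 ρ e u) (h1 : Integrable 𝒱) :
    e = ρ / 2 * (∫ x, 𝒱 x) - ρ / 2 * ∫ x, u x * 𝒱 x := by
  have h := hu.energy
  unfold EnergyConstraint at h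
  have hsplit : ∫ x, (1 - u x) * 𝒱 x = (∫ x, 𝒱 x) - ∫ x, u x * 𝒱 x := by
    have hfun : (fun x => (1 - u x) * 𝒱 x) = fun x => 𝒱 x - u x * 𝒱 x := by
      funext x; ring
    rw [hfun, integral_sub h1 (hu.integrable_mul h1)]
  rw [h, hsplit]
  ring

/-- **`0 ≤ (ρ/2)∫𝒱 − e = (ρ/2)∫u𝒱`**: the printed remark `e ≤ (ρ/2)∫𝒱` of CJL-I §3.1 ((3.2)),
for `𝒱 ≥ 0` integrable and `ρ ≥ 0`. [cite: CarlenJauslinLieb2020, §3.1 (3.2)] -/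
theorem IsSolution.energy_le {𝒱 : Space → ℝ} {ρ e : ℝ} {u : Space → ℝ}
    (hu : IsSolution 𝒱 ρ e u) (h0 : ∀ x, 0 ≤ 𝒱 x) (h1 : Integrable 𝒱) (hρ : 0 ≤ ρ) :
    e ≤ ρ / 2 * ∫ x, 𝒱 x := by
  have h := hu.two_mul_le h0 h1 hρ
  linarith

/-! ## The high-density half of Theorem 2 -/

/-- **CJL-I Theorem 2, high-density half (proved).** "For high density, in any dimension,
`e = (ρ/2)∫𝒱(x)dx + o(ρ)`" — here on `ℝ³`, for `𝒱 ≥ 0` integrable and square-integrable, in the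
uniform rendering of `CarlenJauslinLieb2020_thm2`: for every `ε > 0` there is `ρ₁` such that every
solution triple `(ρ, e, u)` with `ρ > ρ₁`, `e > 0` has `|e − (ρ/2)∫𝒱| ≤ ερ`. Proof (CJL-I §3.1):
`(ρ/2)∫𝒱 − e = (ρ/2)∫u𝒱` and `∫u = 1/ρ` (`IsSolution.integral_eq`); we bound
`2∫u𝒱 ≤ t∫u + t⁻¹∫𝒱² = t/ρ + t⁻¹∫𝒱²` with `t = ∫𝒱²/(2ε) + ε` (in place of the printed
level-set splitting, which needs only `𝒱 ∈ L¹`), whence `ρ₁ = t/(2ε)`.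
[cite: CarlenJauslinLieb2020, Theorem 2 (largerho) and §3.1] -/
theorem CarlenJauslinLieb2020_thm2_highDensity (𝒱 : Space → ℝ) (h0 : ∀ x, 0 ≤ 𝒱 x)
    (h1 : Integrable 𝒱) (h2 : MemLp 𝒱 2) :
    ∀ ε : ℝ, 0 < ε → ∃ ρ₁ : ℝ,
      ∀ (ρ e : ℝ) (u : Space → ℝ), ρ₁ < ρ → 0 < e → IsSolution 𝒱 ρ e u →
        |e - ρ / 2 * ∫ x, 𝒱 x| ≤ ε * ρ := by
  intro ε hε
  set M : ℝ := ∫ x, 𝒱 x ^ 2 with hM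
  have hM0 : 0 ≤ M := integral_nonneg fun x => sq_nonneg _
  set t : ℝ := M / (2 * ε) + ε with ht
  have ht0 : 0 < t := by positivity
  refine ⟨t / (2 * ε), fun ρ e u hρ he hu => ?_⟩
  have hρ0 : 0 < ρ := lt_of_le_of_lt (by positivity) hρ
  have hIu : ∫ x, u x = 1 / ρ := hu.integral_eq h1 hρ0 he
  have huV : Integrable fun x => u x * 𝒱 x := hu.integrable_mul h1
  have hV2 : Integrable fun x => 𝒱 x ^ 2 := h2.integrable_sq
  -- pointwise: `u𝒱 ≤ (t/2)u + 𝒱²/(2t)` from `(tu − 𝒱)² ≥ 0` and `u² ≤ u`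
  have hpt : ∀ x, u x * 𝒱 x ≤ t / 2 * u x + 1 / (2 * t) * 𝒱 x ^ 2 := by
    intro x
    have hu0 := hu.nonneg x
    have hu1 := hu.le_one x
    have hsq : u x ^ 2 ≤ u x := by nlinarith
    have key : t * (2 * (u x * 𝒱 x)) ≤ t * (t * u x + 1 / t * 𝒱 x ^ 2) := by
      have hexp : t * (t * u x + 1 / t * 𝒱 x ^ 2) = t ^ 2 * u x + 𝒱 x ^ 2 := by
        field_simp
      rw [hexp]
      nlinarith [sq_nonneg (t * u x - 𝒱 x), mul_le_mul_of_nonneg_left hsq (sq_nonneg t)]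
    have key' : 2 * (u x * 𝒱 x) ≤ t * u x + 1 / t * 𝒱 x ^ 2 := le_of_mul_le_mul_left key ht0
    have hrw : 1 / (2 * t) * 𝒱 x ^ 2 = (1 / t * 𝒱 x ^ 2) / 2 := by
      field_simp
    rw [hrw]
    linarith
  have hint : ∫ x, u x * 𝒱 x ≤ t / 2 * (∫ x, u x) + 1 / (2 * t) * ∫ x, 𝒱 x ^ 2 := by
    calc ∫ x, u x * 𝒱 x ≤ ∫ x, (t / 2 * u x + 1 / (2 * t) * 𝒱 x ^ 2) :=
          integral_mono huV ((hu.integrable.const_mul _).add (hV2.const_mul _)) hpt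
      _ = t / 2 * (∫ x, u x) + 1 / (2 * t) * ∫ x, 𝒱 x ^ 2 := by
          rw [integral_add (hu.integrable.const_mul _) (hV2.const_mul _), integral_const_mul,
            integral_const_mul]
  have hnonneg : 0 ≤ ∫ x, u x * 𝒱 x := integral_nonneg fun x => mul_nonneg (hu.nonneg x) (h0 x)
  have habs : |e - ρ / 2 * ∫ x, 𝒱 x| = ρ / 2 * ∫ x, u x * 𝒱 x := by
    have hx : e - ρ / 2 * (∫ x, 𝒱 x) = -(ρ / 2 * ∫ x, u x * 𝒱 x) := by
      rw [hu.energy_eq_sub h1]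
      ring
    rw [hx, abs_neg, abs_of_nonneg (by positivity)]
  rw [habs]
  -- `M/(2t) ≤ ε` by the choice of `t`, and `t/4 < ερ/2` by `ρ > t/(2ε)`
  have hB : 1 / (2 * t) * M ≤ ε := by
    rw [div_mul_eq_mul_div, one_mul, div_le_iff₀ (by positivity)]
    have h2t : ε * (2 * t) = M + 2 * ε ^ 2 := by
      rw [ht]
      field_simp
    nlinarith [h2t, sq_nonneg ε]
  have hA : t < ρ * (2 * ε) := (div_lt_iff₀ (by positivity)).1 hρ
  calc ρ / 2 * ∫ x, u x * 𝒱 x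
      ≤ ρ / 2 * (t / 2 * (∫ x, u x) + 1 / (2 * t) * ∫ x, 𝒱 x ^ 2) :=
        mul_le_mul_of_nonneg_left hint (by positivity)
    _ = t / 4 + ρ / 2 * (1 / (2 * t) * M) := by
        rw [hIu, ← hM]
        field_simp
        ring
    _ ≤ t / 4 + ρ / 2 * ε := by
        have := mul_le_mul_of_nonneg_left hB (by positivity : (0 : ℝ) ≤ ρ / 2)
        linarith
    _ ≤ ε * ρ := by nlinarith [hA, hρ0.le, hε.le]

/-! ## The first sentence of Theorem 2, from Theorem 1 -/

/-- **Theorem 1 ⟹ for each `ρ > 0` there is an energy `e > 0` with `ρ(e) = ρ`** (CJL-I, third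
remark after Theorem 1 and the last lemma of §2: "Since `lim_{e→0}ρ(e) = 0` and
`lim_{e→∞}ρ(e) = ∞`, the continuity of `e ↦ ρ(e)` implies that for each `ρ ∈ (0,∞)` there is at
least one `e` such that `ρ(e) = ρ`"), by the intermediate value theorem on `[e₁, e₂] ⊂ (0,∞)` with
`ρ(e₁) < ρ < ρ(e₂)`; "`ρ = ρ(e)`" rendered as "a solution exists at `(ρ, e)`".
[cite: CarlenJauslinLieb2020, Theorem 1 (Remark 3) and §2 (last lemma)] -/
theorem exists_energy_of_thm1 (h : CarlenJauslinLieb2020_thm1) {𝒱 : Space → ℝ} {p : ℝ≥0∞}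
    (hp : 3 / 2 < p) (h0 : ∀ x, 0 ≤ 𝒱 x) (h1 : Integrable 𝒱) (h2 : MemLp 𝒱 p)
    (hne : 0 < ∫ x, 𝒱 x) {ρ : ℝ} (hρ : 0 < ρ) :
    ∃ e : ℝ, 0 < e ∧ ∃ u, IsSolution 𝒱 ρ e u := by
  obtain ⟨ρf, hcont, hzero, htop, hρf⟩ := h 𝒱 p hp h0 h1 h2 hne
  -- small energies: `ρf e₁ < ρ` for some `e₁ > 0`
  have hev₁ : ∀ᶠ e in 𝓝[>] (0 : ℝ), ρf e < ρ ∧ e ∈ Ioi (0 : ℝ) :=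
    (hzero.eventually (gt_mem_nhds hρ)).and self_mem_nhdsWithin
  obtain ⟨e₁, he₁ρ, he₁⟩ := hev₁.exists
  rw [mem_Ioi] at he₁
  -- large energies: `ρ < ρf e₂` for some `e₂ ≥ e₁`
  have hev₂ : ∀ᶠ e in atTop, ρ < ρf e ∧ e₁ ≤ e :=
    (htop.eventually (eventually_gt_atTop ρ)).and (eventually_ge_atTop e₁)
  obtain ⟨e₂, he₂ρ, he₁₂⟩ := hev₂.exists
  have hcont' : ContinuousOn ρf (Icc e₁ e₂) := hcont.mono fun e he => lt_of_lt_of_le he₁ he.1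
  obtain ⟨e, ⟨hee₁, -⟩, heq⟩ := intermediate_value_Icc he₁₂ hcont' ⟨he₁ρ.le, he₂ρ.le⟩
  have he : 0 < e := lt_of_lt_of_le he₁ hee₁
  obtain ⟨⟨u, hu, -⟩, -⟩ := hρf e he
  exact ⟨e, he, u, heq ▸ hu⟩

/-- **CJL-I Theorem 2, first sentence, from Theorem 1**: "for each `ρ > 0` there is at least one
`e > 0` such that `ρ = ρ(e)`", for `𝒱 ≥ 0` integrable, square-integrable (`p = 2 > 3/2`), `𝒱 ≢ 0`
— the first conjunct of `CarlenJauslinLieb2020_thm2`, conditional on the named fact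
`CarlenJauslinLieb2020_thm1`. [cite: CarlenJauslinLieb2020, Theorem 2 and Theorem 1 (Remark 3)] -/
theorem CarlenJauslinLieb2020_thm2_exists_of_thm1 (h : CarlenJauslinLieb2020_thm1)
    (𝒱 : Space → ℝ) (h0 : ∀ x, 0 ≤ 𝒱 x) (h1 : Integrable 𝒱) (h2 : MemLp 𝒱 2)
    (hne : 0 < ∫ x, 𝒱 x) :
    ∀ ρ : ℝ, 0 < ρ → ∃ e : ℝ, 0 < e ∧ ∃ u, IsSolution 𝒱 ρ e u := fun _ hρ =>
  exists_energy_of_thm1 h three_halves_lt_two h0 h1 h2 hne hρ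

end LiebSimpleEquation

end Literature.MathematicalPhysics.QuantumManyBody

end
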